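import Mathlib
import HarnessLib
import Summits.KontsevichZagierPeriods.Zeta5Search.DougallComplexH0
import Summits.KontsevichZagierPeriods.Zeta5Search.BarnesCube
import Literature.NumberTheory.Irrationality.Zudilin2002.WellPoisedIntegrals

/-!
# ζ(5) search — the base case `S(1)` of Zudilin's identity (4) at complex parameters (cell `pub-zeta5`, ct-1 g28)

HONEST FRAMING: systematic search; no irrationality claim unless kernel-certified.  An identity of special functions (Dougall's
`₅F₄(1)` sum in Gamma form = a Beta integral); nothing here is an irrationality result, a worthiness exponent or a denominator statement;
no named fact is discharged; no definition is introduced.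

Brick B6e-3 (base) of `HOME/ct-1/g28/VWP-BLUEPRINT-g28.md` §5: the induction of the corrected route is over COMPLEX `g₁, g₂, g₃` (the step
calls `S(1)` at `g₁ = −s`), so the typed-shape identity with one integration variable is needed at complex parameters:

* `J_one_eq` — `∫_{[0,1]^1} ∏_{j:Fin 1} x_j^{a−1}(1−x_j)^{b−a−1}·Q₁(x)^{−a₀} dx = Γ(a)Γ(b−a−a₀)/Γ(b−a₀)` (`Re a > 0`, `Re(b−a−a₀) > 0`; complex Beta,
  `BarnesCube.integral_beta_Ioo`);
* `F_three_eq` — the typed-shape series `Σ_μ (g₀+2μ)∏_{i<4}Γ(g_i+μ)/Γ(1+g₀−g_i+μ)(−1)^{4μ}` in Gamma form (g26's `zudilin_nine_complex'`);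
* **`S_one`** — `S(1)(g)` for complex `g` with `Re g_i > 0` (`i ≤ 3`) and `Re(g₁+g₂+g₃) < 1 + Re g₀`.

Theorems only; imports `DougallComplexH0`, `BarnesCube`, the typed `WellPoisedIntegrals` (for `nestedQ`).
-/

noncomputable section

namespace Summit.KontsevichZagierPeriods.Zeta5Search.VWPBaseCase

open MeasureTheory Set
open Literature.NumberTheory.Irrationality.Zudilin2002 (nestedQ)
open Summit.KontsevichZagierPeriods.Zeta5Search.DougallComplexH0 (zudilin_nine_complex')
open Summit.KontsevichZagierPeriods.Zeta5Search.BarnesCube (integral_beta_Ioo)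

/-! ### 1. The one-variable integral -/

/-- **`J₁` at complex parameters**: `∫_{[0,1]^1} x₀^{a−1}(1−x₀)^{b−a−1} Q₁^{−a₀} = Γ(a)Γ(b−a−a₀)/Γ(b−a₀)` for `Re a > 0`, `Re(b−a−a₀) > 0`
(`Q₁(x₀) = 1 − x₀`; Euler's Beta integral). -/
theorem J_one_eq (a₀ a b : ℂ) (ha : 0 < a.re) (hb : 0 < (b - a - a₀).re) :
    ∫ x in Set.pi univ (fun _ : Fin 1 => Icc (0 : ℝ) 1),
        (∏ j : Fin 1, ((x j : ℝ) : ℂ) ^ (a - 1) * (1 - ((x j : ℝ) : ℂ)) ^ (b - a - 1)) * ((nestedQ (List.ofFn x) : ℝ) : ℂ) ^ (-a₀) =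
      Complex.Gamma a * Complex.Gamma (b - a - a₀) / Complex.Gamma (b - a₀) := by
  have hQ : ∀ x : Fin 1 → ℝ, nestedQ (List.ofFn x) = 1 - x 0 := fun x => by simp [nestedQ, List.ofFn_succ]
  have hpre : Set.pi Set.univ (fun _ : Fin 1 => Icc (0 : ℝ) 1) = MeasurableEquiv.funUnique (Fin 1) ℝ ⁻¹' Icc 0 1 := by
    ext x
    simp [MeasurableEquiv.funUnique, Fin.default_eq_zero, Pi.le_def, Fin.forall_fin_one]
  have htrans := (volume_preserving_funUnique (Fin 1) ℝ).setIntegral_preimage_emb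
    (MeasurableEquiv.funUnique (Fin 1) ℝ).measurableEmbedding
    (fun t : ℝ => (t : ℂ) ^ (a - 1) * (1 - (t : ℂ)) ^ (b - a - 1) * ((1 - t : ℝ) : ℂ) ^ (-a₀)) (Icc 0 1)
  have hlhs : (∫ x in Set.pi univ (fun _ : Fin 1 => Icc (0 : ℝ) 1),
        (∏ j : Fin 1, ((x j : ℝ) : ℂ) ^ (a - 1) * (1 - ((x j : ℝ) : ℂ)) ^ (b - a - 1)) * ((nestedQ (List.ofFn x) : ℝ) : ℂ) ^ (-a₀)) =
      ∫ t in Icc (0 : ℝ) 1, (t : ℂ) ^ (a - 1) * (1 - (t : ℂ)) ^ (b - a - 1) * ((1 - t : ℝ) : ℂ) ^ (-a₀) := by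
    rw [hpre, ← htrans]
    refine setIntegral_congr_fun ((MeasurableEquiv.funUnique (Fin 1) ℝ).measurable measurableSet_Icc) fun x _ => ?_
    rw [Fin.prod_univ_one, hQ x]
    simp [MeasurableEquiv.funUnique, Fin.default_eq_zero]
  rw [hlhs, integral_Icc_eq_integral_Ioo]
  have hcongr : EqOn (fun t : ℝ => (t : ℂ) ^ (a - 1) * (1 - (t : ℂ)) ^ (b - a - 1) * ((1 - t : ℝ) : ℂ) ^ (-a₀))
      (fun t : ℝ => (t : ℂ) ^ (a - 1) * (1 - (t : ℂ)) ^ ((b - a - a₀) - 1)) (Ioo (0 : ℝ) 1) := by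
    intro t ht
    have h1t : (1 : ℂ) - (t : ℂ) ≠ 0 := by
      have : (0 : ℝ) < 1 - t := by linarith [ht.2]
      exact_mod_cast this.ne'
    simp only
    push_cast
    rw [mul_assoc, ← Complex.cpow_add _ _ h1t]
    ring_nf
  rw [setIntegral_congr_fun measurableSet_Ioo hcongr, integral_beta_Ioo ha hb]
  ring_nf

/-! ### 2. The series with three parameters in Gamma form -/

/-- **`F₃` in the typed shape, complex parameters** (Dougall): for `Re g_i > 0` (`i ≤ 3`) and `Re(g₁+g₂+g₃) < 1 + Re g₀`,
`Σ_μ (g₀+2μ)∏_{i<4}Γ(g_i+μ)/Γ(1+g₀−g_i+μ)·(−1)^{4μ} = Γ(g₁)Γ(g₂)Γ(g₃)Γ(g₀−g₁−g₂−g₃+1)/(Γ(g₀−g₁−g₂+1)Γ(g₀−g₁−g₃+1)Γ(g₀−g₂−g₃+1))`. -/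
theorem F_three_eq (g : ℕ → ℂ) (h0 : 0 < (g 0).re) (h1 : 0 < (g 1).re) (h2 : 0 < (g 2).re) (h3 : 0 < (g 3).re)
    (hs : (g 1).re + (g 2).re + (g 3).re < 1 + (g 0).re) :
    ∑' μ : ℕ, (g 0 + 2 * (μ : ℂ)) * (∏ i ∈ Finset.range 4, Complex.Gamma (g i + μ) / Complex.Gamma (1 + g 0 - g i + μ)) *
        (-1 : ℂ) ^ ((1 + 3) * μ) =
      Complex.Gamma (g 1) * Complex.Gamma (g 2) * Complex.Gamma (g 3) * Complex.Gamma (g 0 - g 1 - g 2 - g 3 + 1) /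
        (Complex.Gamma (g 0 - g 1 - g 2 + 1) * Complex.Gamma (g 0 - g 1 - g 3 + 1) * Complex.Gamma (g 0 - g 2 - g 3 + 1)) := by
  rw [← zudilin_nine_complex' (g 0) (g 1) (g 2) (g 3) h0 h1 h2 h3 hs]
  refine tsum_congr fun μ => ?_
  have hpow : (-1 : ℂ) ^ ((1 + 3) * μ) = 1 := by
    rw [show (1 + 3) * μ = 2 * (2 * μ) by ring, pow_mul]; norm_num
  rw [hpow, mul_one]
  simp only [Finset.prod_range_succ, Finset.prod_range_zero, one_mul]
  rw [show (1 : ℂ) + g 0 - g 0 + μ = (μ : ℂ) + 1 by ring, show (1 : ℂ) + g 0 - g 1 + μ = g 0 - g 1 + 1 + μ by ring,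
    show (1 : ℂ) + g 0 - g 2 + μ = g 0 - g 2 + 1 + μ by ring, show (1 : ℂ) + g 0 - g 3 + μ = g 0 - g 3 + 1 + μ by ring]
  ring

/-! ### 3. `S(1)` -/

/-- **The base case `S(1)(g)` at complex parameters** [Zudilin math/0206177, Lemma 1 = Dougall + Beta]: for `g : ℕ → ℂ` with
`Re g_i > 0` (`i ≤ 3`) and `Re(g₁+g₂+g₃) < 1 + Re g₀`, in the typed shapes,
`(∏_{i∈Icc 1 2}Γ(1+g₀−g_i−g_{i+1}))/(Γ(g₁)Γ(g₃)) · Σ_μ (g₀+2μ)∏_{i<4}Γ(g_i+μ)/Γ(1+g₀−g_i+μ)(−1)^{4μ}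
   = ∫_{[0,1]^1} ∏_{j:Fin 1} x_j^{g_{j+2}−1}(1−x_j)^{(1+g₀−g_{j+3})−g_{j+2}−1} Q₁^{−g₁}`. -/
theorem S_one (g : ℕ → ℂ) (h0 : 0 < (g 0).re) (h1 : 0 < (g 1).re) (h2 : 0 < (g 2).re) (h3 : 0 < (g 3).re)
    (hs : (g 1).re + (g 2).re + (g 3).re < 1 + (g 0).re) :
    (∏ i ∈ Finset.Icc 1 (1 + 1), Complex.Gamma (1 + g 0 - g i - g (i + 1))) / (Complex.Gamma (g 1) * Complex.Gamma (g (1 + 2))) *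
        (∑' μ : ℕ, (g 0 + 2 * (μ : ℂ)) * (∏ i ∈ Finset.range (1 + 3), Complex.Gamma (g i + μ) / Complex.Gamma (1 + g 0 - g i + μ)) *
          (-1 : ℂ) ^ ((1 + 3) * μ)) =
      ∫ x in Set.pi univ (fun _ : Fin 1 => Icc (0 : ℝ) 1),
        (∏ j : Fin 1, ((x j : ℝ) : ℂ) ^ (g (j + 2) - 1) * (1 - ((x j : ℝ) : ℂ)) ^ ((1 + g 0 - g (j + 3)) - g (j + 2) - 1)) *
          ((nestedQ (List.ofFn x) : ℝ) : ℂ) ^ (-g 1) := by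
  have hJ := J_one_eq (g 1) (g 2) (1 + g 0 - g 3) h2 (by simp; linarith)
  have hJ' : (∫ x in Set.pi univ (fun _ : Fin 1 => Icc (0 : ℝ) 1),
        (∏ j : Fin 1, ((x j : ℝ) : ℂ) ^ (g (j + 2) - 1) * (1 - ((x j : ℝ) : ℂ)) ^ ((1 + g 0 - g (j + 3)) - g (j + 2) - 1)) *
          ((nestedQ (List.ofFn x) : ℝ) : ℂ) ^ (-g 1)) =
      Complex.Gamma (g 2) * Complex.Gamma (1 + g 0 - g 3 - g 2 - g 1) / Complex.Gamma (1 + g 0 - g 3 - g 1) := by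
    rw [← hJ]
    refine setIntegral_congr_fun (MeasurableSet.univ_pi fun _ => measurableSet_Icc) fun x _ => ?_
    simp
  rw [hJ', show 1 + 3 = 4 by rfl, F_three_eq g h0 h1 h2 h3 hs]
  have hI : Finset.Icc 1 (1 + 1) = {1, 2} := by decide
  rw [hI, Finset.prod_insert (by decide), Finset.prod_singleton]
  have hΓ1 : Complex.Gamma (g 1) ≠ 0 := Complex.Gamma_ne_zero_of_re_pos h1
  have hΓ3 : Complex.Gamma (g (1 + 2)) ≠ 0 := Complex.Gamma_ne_zero_of_re_pos (by simpa using h3)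
  have hΓ12 : Complex.Gamma (g 0 - g 1 - g 2 + 1) ≠ 0 := Complex.Gamma_ne_zero_of_re_pos (by simp; linarith)
  have hΓ13 : Complex.Gamma (g 0 - g 1 - g 3 + 1) ≠ 0 := Complex.Gamma_ne_zero_of_re_pos (by simp; linarith)
  have hΓ23 : Complex.Gamma (g 0 - g 2 - g 3 + 1) ≠ 0 := Complex.Gamma_ne_zero_of_re_pos (by simp; linarith)
  rw [show (1 : ℂ) + g 0 - g 1 - g (1 + 1) = g 0 - g 1 - g 2 + 1 by norm_num; ring,
    show (1 : ℂ) + g 0 - g 2 - g (2 + 1) = g 0 - g 2 - g 3 + 1 by norm_num; ring,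
    show (1 : ℂ) + g 0 - g 3 - g 2 - g 1 = g 0 - g 1 - g 2 - g 3 + 1 by ring,
    show (1 : ℂ) + g 0 - g 3 - g 1 = g 0 - g 1 - g 3 + 1 by ring,
    show g (1 + 2) = g 3 by norm_num] at *
  field_simp

end Summit.KontsevichZagierPeriods.Zeta5Search.VWPBaseCase

end
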